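import Literature.NumberTheory.LFunctions.Polymath15EffectiveApproximationProofs
import Literature.Analysis.SpecialFunctions.GammaStirlingComplex
import Mathlib.Analysis.SpecialFunctions.Gaussian.GaussianIntegral
import Mathlib.Analysis.Complex.CauchyIntegral
import Mathlib.MeasureTheory.Group.Integral
import HarnessLib

/-!
# Polymath 15, Proposition 6.1: the estimate for the heat-flowed Riemann–Siegel terms `r_{t,n}`

Topic `Literature/NumberTheory/LFunctions` (companion of `Polymath15EffectiveApproximation.lean`,
which vendors the objects `M₀`, `α`, `M_t`, `b_n^t` of Polymath 15, §1 and Thm. 1.3 — the effective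
approximation `H_t ≈ B_t f_t` — as the named fact `Polymath15.effective_approximation`, and of
`Polymath15EffectiveApproximationProofs.lean`, which proves the parameter bounds of Thm. 1.3 and
provides the branch `log M₀` with `(log M₀)' = α`). Everything here is PROVED; there are no named
facts. This is item **E1** of the typed decomposition of the printed proof of Thm. 1.3
(§4 + §6 of the source): `E0` heat-flowed Riemann–Siegel expansion of `H_t`, `E1` = Prop. 6.1,
`E2` = Arias de Reyna's bounds (`RiemannSiegelLehmerBounds.lean`), `E3` = Prop. 6.3,
`E4` = Cors. 6.4/6.5 and Prop. 6.6.

## Contents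

* **§4 objects**: `xiFactor s = (1/8)(s(s−1)/2) π^{−s/2} Γ(s/2)`, `r0 n s = xiFactor s · n^{−s}`
  (eq. (ron-def)), the forward heat flow `heatAvg t F s = ∫_ℝ F(s + √t v) e^{−v²}/√π dv` and
  `rt t n = heatAvg t (r0 n)` (the definition of `r_{t,n}` after eq. (htz-expand), UNSHIFTED form);
  the quantities of Prop. 6.1: `epsTN` (eq. (eps-def)) and the main term `rtMain`.
* **"We may shift contours"** (§4, eqs. (rtn-def)/(RTN-def)), as a general theorem
  `integral_gaussian_shift`: for `G` holomorphic on the closed strip between `Im = 0` and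
  `Im = Im c` with `‖G w‖ ≤ B e^{A‖w‖²}`, `A < 1`, `∫ G(v+c) e^{−(v+c)²} dv = ∫ G(v) e^{−v²} dv`
  (Cauchy–Goursat on `[−R, R] × [0, Im c]`, Mathlib's
  `Complex.integral_boundary_rect_eq_zero_of_differentiableOn`, the vertical sides being
  `O(e^{−(1−A)R²})`, then the real translation by `Re c`); with `integrable_gaussian_shift`.
* **Lemma 5.1 (v) for `r_{0,n}`**: `exists_r0_eq` — `r_{0,n}(s) = M₀(s) n^{−s} e^{O_≤(1/(6(Im s − 2)))}`
  for `Im s > 2`, from the tree's complex Stirling formula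
  `GammaStirling.exists_Gamma_eq_exp_stirling_of_one_lt_im` (whose remainder is measured by `Im`;
  the source quotes Boyd's `1/(6(|s| − 0.66))` — inside the slack of the printed proof, which
  replaces `T − 0.74` by `T − 3.08` anyway).
* **(alpha-deriv-bound) and Taylor**: `norm_deriv_alpha_le_of_im` (`|α'| ≤ 1/(2 Im s − 6)` for
  `Im s > 3`), `norm_alpha_sub_alpha_le_of_im`, and the second-order expansion
  `norm_logM₀_taylor_le`: `|log M₀(s+h) − log M₀(s) − α(s)h| ≤ |h|²/(2(2T₀ − 6))` when
  `Im s, Im(s+h) ≥ T₀ > 3` (via `image_norm_le_of_norm_deriv_right_le_deriv_boundary`);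
  `im_alpha_ge` (eq. (iman): `Im α(s) ≥ −1/(2T) − 1/T`).
* **Prop. 6.1**: `norm_rt_sub_rtMain_le` / `rtn_estimate` — for `σ ∈ ℝ`, `T > 10`, `n ≥ 1`,
  `0 < t ≤ 1/2`: `|r_{t,n}(σ+iT) − main| ≤ |main| ε_{t,n}(σ+iT)`,
  `main = M_t(σ+iT) b_n^t n^{−(σ+iT+(t/2)α(σ+iT))}`. The proof follows the printed one line by
  line: `strip_im_ge` (the shifted points have `Im ≥ T − 0.08`), `exists_shifted_integrand_eq`
  (the integrand after the shift equals `(e^{−v²}/√π) · main · e^{E}`,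
  `|E| ≤ ((t/2)v² + (t²/8)|α_n|² + 1/6)/(T − 3.08)`), `norm_r0_heat_le` (sub-Gaussian growth,
  justifying the shift), `eps_ineq` (the Gaussian integral `(1 − t/(2(T−3.08)))^{−1/2}` and
  Lemma 5.1 (ii)).

## Deviations from the printed proof

None in structure. Constants: Lemma 5.1 (v) is used with the tree's remainder `1/(12(Im z − 1))`
(`Im z > 1`) instead of Boyd's `1/(12(|z| − 0.33))`; at the points of the proof
(`Im ≥ T − 0.08 > 9.9`) this gives `O_≤(1/(6(T − 2.08)))`, within the printed `O_≤(1/(6(T − 3.08)))`.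
The sub-Gaussian growth of `r_{0,n}` on the strip ("grow slower than gaussian … from Stirling's
approximation") is obtained from the same Taylor bound for `log M₀` rather than from Stirling's
formula directly.

## References

* D. H. J. Polymath, *Effective approximation of heat flow evolution of the Riemann `ξ` function,
  and a new upper bound for the de Bruijn–Newman constant*, Res. Math. Sci. 6 (2019), Paper 31
  (arXiv:1904.12438): §4 (eqs. (ron-def), (htz-expand), (rtn-def)), Lemma 5.1, §6.1
  (eqs. (alpha-deriv), (alpha-deriv-bound), Prop. 6.1 with eqs. (eps-def), (alphan-def), (iman),
  (gauss-bound)). [Polymath2019]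
-/

noncomputable section

open Complex MeasureTheory Set Filter Topology intervalIntegral

open scoped Real ComplexConjugate Interval

namespace Literature.NumberTheory.LFunctions

namespace Polymath15

/-! ## Shifting the contour of a Gaussian integral (§4: "we may shift contours") -/

section GaussShift

variable {G : ℂ → ℂ} {c : ℂ} {A B : ℝ}

/-- The norm of the Gaussian along a horizontal line: `‖e^{−(x+iy)²}‖ = e^{y² − x²}`. [folklore] -/
private theorem norm_cexp_neg_sq_add_mul_I (x y : ℝ) :
    ‖cexp (-((x : ℂ) + y * I) ^ 2)‖ = Real.exp (y ^ 2 - x ^ 2) := by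
  rw [Complex.norm_exp]
  congr 1
  simp [sq, Complex.mul_re, Complex.mul_im]

/-- Pointwise bound for `G(w) e^{−w²}` on the line `Im w = y` of the strip, from the sub-Gaussian
growth `‖G w‖ ≤ B e^{A ‖w‖²}`: `‖G(x+iy) e^{−(x+iy)²}‖ ≤ B e^{(|A|+1) y²} e^{−(1−A) x²}`. [folklore] -/
private theorem norm_mul_cexp_neg_sq_le
    (hg : ∀ w : ℂ, w.im ∈ uIcc 0 c.im → ‖G w‖ ≤ B * Real.exp (A * ‖w‖ ^ 2))
    {y : ℝ} (hy : y ∈ uIcc 0 c.im) (x : ℝ) :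
    ‖G (x + y * I) * cexp (-((x : ℂ) + y * I) ^ 2)‖ ≤
      B * Real.exp ((|A| + 1) * y ^ 2) * Real.exp (-(1 - A) * x ^ 2) := by
  have hw : ((x : ℂ) + y * I).im ∈ uIcc 0 c.im := by simpa using hy
  have h1 := hg _ hw
  have hn : ‖(x : ℂ) + y * I‖ ^ 2 = x ^ 2 + y ^ 2 := by
    rw [Complex.sq_norm, Complex.normSq_apply]
    simp [sq]
  rw [norm_mul, norm_cexp_neg_sq_add_mul_I]
  rw [hn] at h1
  have hB : 0 ≤ B := by
    have := (norm_nonneg _).trans h1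
    exact nonneg_of_mul_nonneg_left this (Real.exp_pos _)
  calc ‖G (x + y * I)‖ * Real.exp (y ^ 2 - x ^ 2)
      ≤ B * Real.exp (A * (x ^ 2 + y ^ 2)) * Real.exp (y ^ 2 - x ^ 2) := by gcongr
    _ = B * (Real.exp (A * y ^ 2 + y ^ 2) * Real.exp (-(1 - A) * x ^ 2)) := by
        rw [mul_assoc, ← Real.exp_add, ← Real.exp_add]; ring_nf
    _ ≤ B * (Real.exp ((|A| + 1) * y ^ 2) * Real.exp (-(1 - A) * x ^ 2)) := by
        gcongr
        nlinarith [le_abs_self A, sq_nonneg y]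
    _ = _ := by ring

/-- On each horizontal line of the strip the integrand `x ↦ G(x+iy) e^{−(x+iy)²}` is continuous
(from the complex differentiability of `G` on the strip). [folklore] -/
private theorem continuous_mul_cexp_neg_sq_line
    (hd : ∀ w : ℂ, w.im ∈ uIcc 0 c.im → DifferentiableAt ℂ G w) {y : ℝ} (hy : y ∈ uIcc 0 c.im) :
    Continuous fun x : ℝ ↦ G (x + y * I) * cexp (-((x : ℂ) + y * I) ^ 2) := by
  have hG : Continuous fun x : ℝ ↦ G (x + y * I) := by
    refine continuous_iff_continuousAt.2 fun x ↦ ?_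
    have hw : ((x : ℂ) + y * I).im ∈ uIcc 0 c.im := by simpa using hy
    have h2 : ContinuousAt G ((x : ℂ) + y * I) := (hd _ hw).continuousAt
    exact ContinuousAt.comp (g := G) (f := fun x : ℝ ↦ (x : ℂ) + y * I) h2
      (by fun_prop : Continuous fun x : ℝ ↦ (x : ℂ) + y * I).continuousAt
  exact hG.mul (by fun_prop)

/-- Integrability of `x ↦ G(x+iy) e^{−(x+iy)²}` on each line of the strip (sub-Gaussian growth with
`A < 1` against the Gaussian: "the functions … grow slower than gaussian as `v → ±∞`").
[cite: Polymath2019, §4, after eq. (RON-def)] -/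
theorem integrable_mul_cexp_neg_sq_line (hA : A < 1)
    (hd : ∀ w : ℂ, w.im ∈ uIcc 0 c.im → DifferentiableAt ℂ G w)
    (hg : ∀ w : ℂ, w.im ∈ uIcc 0 c.im → ‖G w‖ ≤ B * Real.exp (A * ‖w‖ ^ 2))
    {y : ℝ} (hy : y ∈ uIcc 0 c.im) :
    Integrable fun x : ℝ ↦ G (x + y * I) * cexp (-((x : ℂ) + y * I) ^ 2) := by
  have hmaj : Integrable fun x : ℝ ↦
      B * Real.exp ((|A| + 1) * y ^ 2) * Real.exp (-(1 - A) * x ^ 2) :=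
    (integrable_exp_neg_mul_sq (by linarith)).const_mul _
  refine hmaj.mono' (continuous_mul_cexp_neg_sq_line hd hy).aestronglyMeasurable
    (Eventually.of_forall fun x ↦ ?_)
  exact norm_mul_cexp_neg_sq_le hg hy x

/-- The vertical sides of the rectangle: `‖∫_0^{Im c} G(R+iy) e^{−(R+iy)²} dy‖ ≤
B e^{(|A|+1)(Im c)²} |Im c| · e^{−(1−A)R²}`. [folklore] -/
private theorem norm_verticalIntegral_le
    (hg : ∀ w : ℂ, w.im ∈ uIcc 0 c.im → ‖G w‖ ≤ B * Real.exp (A * ‖w‖ ^ 2)) (R : ℝ) :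
    ‖∫ y : ℝ in (0 : ℝ)..c.im, G (R + y * I) * cexp (-((R : ℂ) + y * I) ^ 2)‖ ≤
      B * Real.exp ((|A| + 1) * c.im ^ 2) * |c.im| * Real.exp (-(1 - A) * R ^ 2) := by
  have hB : 0 ≤ B := by
    have h0 : (0 : ℂ).im ∈ uIcc 0 c.im := by simp
    have := (norm_nonneg _).trans (hg 0 h0)
    simpa using this
  have key : ∀ y ∈ Ι (0 : ℝ) c.im, ‖G (R + y * I) * cexp (-((R : ℂ) + y * I) ^ 2)‖ ≤
      B * Real.exp ((|A| + 1) * c.im ^ 2) * Real.exp (-(1 - A) * R ^ 2) := by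
    intro y hy
    have hy' : y ∈ uIcc 0 c.im := uIoc_subset_uIcc hy
    refine (norm_mul_cexp_neg_sq_le hg hy' R).trans ?_
    have hyc : y ^ 2 ≤ c.im ^ 2 := by
      have := abs_sub_left_of_mem_uIcc hy'
      simp only [sub_zero] at this
      exact sq_le_sq.2 this
    gcongr
  refine (intervalIntegral.norm_integral_le_of_norm_le_const key).trans (le_of_eq ?_)
  rw [sub_zero]; ring

/-- The vertical sides vanish as the rectangle grows: `∫_0^{Im c} G(±R+iy) e^{−(±R+iy)²} dy → 0`
as `R → +∞` (for any real-valued reparametrisation `R ↦ ρ R` with `ρ R² → ∞`, used with `ρ = id`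
and `ρ = −id`). [folklore] -/
private theorem tendsto_verticalIntegral (hA : A < 1)
    (hg : ∀ w : ℂ, w.im ∈ uIcc 0 c.im → ‖G w‖ ≤ B * Real.exp (A * ‖w‖ ^ 2))
    {ρ : ℝ → ℝ} (hρ : ∀ R, ρ R ^ 2 = R ^ 2) :
    Tendsto (fun R : ℝ ↦ ∫ y : ℝ in (0 : ℝ)..c.im,
      G (ρ R + y * I) * cexp (-((ρ R : ℂ) + y * I) ^ 2)) atTop (𝓝 0) := by
  rw [tendsto_zero_iff_norm_tendsto_zero]
  have hlim : Tendsto (fun R : ℝ ↦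
      B * Real.exp ((|A| + 1) * c.im ^ 2) * |c.im| * Real.exp (-(1 - A) * R ^ 2)) atTop (𝓝 0) := by
    rw [show (0 : ℝ) = B * Real.exp ((|A| + 1) * c.im ^ 2) * |c.im| * 0 by ring]
    refine Tendsto.const_mul _ ?_
    refine Real.tendsto_exp_atBot.comp ?_
    have h1 : Tendsto (fun R : ℝ ↦ R ^ 2) atTop atTop := tendsto_pow_atTop two_ne_zero
    have h2 : Tendsto (fun R : ℝ ↦ (1 - A) * R ^ 2) atTop atTop :=
      h1.const_mul_atTop (by linarith)
    refine (tendsto_neg_atTop_atBot.comp h2).congr fun R ↦ ?_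
    simp only [Function.comp_apply]
    ring
  refine squeeze_zero (fun R ↦ norm_nonneg _) (fun R ↦ ?_) hlim
  simpa only [hρ] using norm_verticalIntegral_le hg (ρ R)

/-- **Cauchy's theorem for a Gaussian integral on a strip.** If `G` is complex differentiable at
every point of the closed horizontal strip between `Im w = 0` and `Im w = Im c` and of sub-Gaussian
growth there, `‖G w‖ ≤ B e^{A‖w‖²}` with `A < 1`, then
`∫_ℝ G(v + c) e^{−(v+c)²} dv = ∫_ℝ G(v) e^{−v²} dv` ("we may shift contours, replacing `v` by
`v + (√t/2) α_n`", Polymath 15, §4: the rectangle `[−R, R] × [0, Im c]` and `R → ∞`, then a real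
translation). [cite: Polymath2019, §4, eqs. (rtn-def), (RTN-def)] -/
theorem integral_gaussian_shift (hA : A < 1)
    (hd : ∀ w : ℂ, w.im ∈ uIcc 0 c.im → DifferentiableAt ℂ G w)
    (hg : ∀ w : ℂ, w.im ∈ uIcc 0 c.im → ‖G w‖ ≤ B * Real.exp (A * ‖w‖ ^ 2)) :
    ∫ v : ℝ, G (v + c) * cexp (-((v : ℂ) + c) ^ 2) = ∫ v : ℝ, G v * cexp (-(v : ℂ) ^ 2) := by
  set F : ℂ → ℂ := fun w ↦ G w * cexp (-w ^ 2) with hF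
  have h0mem : (0 : ℝ) ∈ uIcc 0 c.im := left_mem_uIcc
  have hcmem : c.im ∈ uIcc 0 c.im := right_mem_uIcc
  -- integrability on the two horizontal lines
  have hint0 : Integrable fun x : ℝ ↦ F x := by
    have := integrable_mul_cexp_neg_sq_line hA hd hg h0mem
    simpa [hF] using this
  have hint1 : Integrable fun x : ℝ ↦ F (x + c.im * I) :=
    integrable_mul_cexp_neg_sq_line hA hd hg hcmem
  -- the rectangle identity
  have hrect : ∀ R : ℝ, (∫ x : ℝ in -R..R, F x) =
      (∫ x : ℝ in -R..R, F (x + c.im * I)) -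
        I * (∫ y : ℝ in (0 : ℝ)..c.im, F (R + y * I)) +
        I * (∫ y : ℝ in (0 : ℝ)..c.im, F (-R + y * I)) := by
    intro R
    have hdiff : DifferentiableOn ℂ F ([[(-(R : ℂ)).re, ((R : ℂ) + c.im * I).re]] ×ℂ
        [[(-(R : ℂ)).im, ((R : ℂ) + c.im * I).im]]) := by
      intro p hp
      have hp2 : p.im ∈ uIcc 0 c.im := by
        have := (mem_reProdIm.1 hp).2
        simpa using this
      exact ((hd p hp2).mul (((differentiableAt_id.pow 2).neg).cexp)).differentiableWithinAt
    have := integral_boundary_rect_eq_zero_of_differentiableOn F (-R) (R + c.im * I) hdiff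
    simp only [neg_im, ofReal_im, neg_zero, ofReal_zero, zero_mul, add_zero, neg_re,
      ofReal_re, add_re, mul_re, I_re, mul_zero, I_im, sub_zero, add_im, mul_im,
      mul_one, zero_add, smul_eq_mul, ofReal_neg] at this
    linear_combination this
  -- limits of the four sides
  have hlim0 : Tendsto (fun R : ℝ ↦ ∫ x : ℝ in -R..R, F x) atTop (𝓝 (∫ x : ℝ, F x)) :=
    intervalIntegral_tendsto_integral hint0 tendsto_neg_atTop_atBot tendsto_id
  have hlim1 : Tendsto (fun R : ℝ ↦ ∫ x : ℝ in -R..R, F (x + c.im * I)) atTop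
      (𝓝 (∫ x : ℝ, F (x + c.im * I))) :=
    intervalIntegral_tendsto_integral hint1 tendsto_neg_atTop_atBot tendsto_id
  have hvert1 : Tendsto (fun R : ℝ ↦ ∫ y : ℝ in (0 : ℝ)..c.im, F (R + y * I)) atTop (𝓝 0) :=
    tendsto_verticalIntegral (ρ := id) hA hg (fun R ↦ rfl)
  have hvert2 : Tendsto (fun R : ℝ ↦ ∫ y : ℝ in (0 : ℝ)..c.im, F (-R + y * I)) atTop (𝓝 0) := by
    have := tendsto_verticalIntegral (ρ := fun R : ℝ ↦ -R) hA hg (fun R ↦ by ring)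
    simpa using this
  have hlim0' : Tendsto (fun R : ℝ ↦ ∫ x : ℝ in -R..R, F x) atTop
      (𝓝 ((∫ x : ℝ, F (x + c.im * I)) - I * 0 + I * 0)) := by
    simp_rw [hrect]
    exact (hlim1.sub (hvert1.const_mul I)).add (hvert2.const_mul I)
  have heq : (∫ x : ℝ, F x) = ∫ x : ℝ, F (x + c.im * I) := by
    have := tendsto_nhds_unique hlim0 hlim0'
    simpa using this
  -- the real translation by `Re c`
  have htrans : (∫ v : ℝ, G (v + c) * cexp (-((v : ℂ) + c) ^ 2)) =
      ∫ v : ℝ, F ((v + c.re : ℝ) + c.im * I) := by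
    refine integral_congr_ae (Eventually.of_forall fun v ↦ ?_)
    have : ((v + c.re : ℝ) : ℂ) + c.im * I = v + c := by
      push_cast
      rw [add_assoc, re_add_im]
    simp only [hF, this]
  rw [htrans, integral_add_right_eq_self (fun u : ℝ ↦ F (u + c.im * I)) c.re, ← heq]

/-- Integrability of the shifted integrand `v ↦ G(v + c) e^{−(v+c)²}` (the line `Im = Im c` of the
strip, translated by `Re c`). [cite: Polymath2019, §4, eqs. (rtn-def), (RTN-def)] -/
theorem integrable_gaussian_shift (hA : A < 1)
    (hd : ∀ w : ℂ, w.im ∈ uIcc 0 c.im → DifferentiableAt ℂ G w)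
    (hg : ∀ w : ℂ, w.im ∈ uIcc 0 c.im → ‖G w‖ ≤ B * Real.exp (A * ‖w‖ ^ 2)) :
    Integrable fun v : ℝ ↦ G (v + c) * cexp (-((v : ℂ) + c) ^ 2) := by
  have h1 := (integrable_mul_cexp_neg_sq_line hA hd hg (right_mem_uIcc (a := (0 : ℝ)))).comp_add_right
    c.re
  refine h1.congr (Eventually.of_forall fun v ↦ ?_)
  have : ((v + c.re : ℝ) : ℂ) + c.im * I = v + c := by
    push_cast
    rw [add_assoc, re_add_im]
  simp only [this]

end GaussShift

/-! ## The objects of §4: `r_{0,n}`, the heat flow, `r_{t,n}`; and of Prop. 6.1 -/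

/-- The true `ξ`-prefactor `(1/8)·(s(s−1)/2)·π^{−s/2}·Γ(s/2)` of `r_{0,n}`, `R_{0,N}` (its Stirling
approximant is `M₀`, Lemma 5.1 (v)). [cite: Polymath2019, §4 eq. (ron-def)] -/
def xiFactor (s : ℂ) : ℂ :=
  1 / 8 * (s * (s - 1) / 2) * (π : ℂ) ^ (-s / 2) * Complex.Gamma (s / 2)

/-- `r_{0,n}(s) = (1/8)(s(s−1)/2) π^{−s/2} Γ(s/2) n^{−s}`. [cite: Polymath2019, §4 eq. (ron-def)] -/
def r0 (n : ℕ) (s : ℂ) : ℂ := xiFactor s * (n : ℂ) ^ (-s)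

/-- Forward heat flow in the horizontal variable,
`F ↦ (s ↦ ∫_ℝ F(s + √t v) (1/√π) e^{−v²} dv)`.
[cite: Polymath2019, §4, definitions of r_{t,n}, R_{t,N}] -/
def heatAvg (t : ℝ) (F : ℂ → ℂ) (s : ℂ) : ℂ :=
  ∫ v : ℝ, ((Real.exp (-v ^ 2) / Real.sqrt π : ℝ) : ℂ) * F (s + Real.sqrt t * v)

/-- `r_{t,n}(s) = ∫_ℝ r_{0,n}(s + √t v) (1/√π) e^{−v²} dv`, the heat flow of `r_{0,n}`.
[cite: Polymath2019, §4, definition of r_{t,n} after eq. (htz-expand)] -/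
def rt (t : ℝ) (n : ℕ) : ℂ → ℂ := heatAvg t (r0 n)

/-- `ε_{t,n}(σ + iT) = exp(((t²/8)|α(σ+iT) − log n|² + t/4 + 1/6)/(T − 3.33)) − 1`.
[cite: Polymath2019, Prop. 6.1 eq. (eps-def)] -/
def epsTN (t : ℝ) (n : ℕ) (s : ℂ) : ℝ :=
  Real.exp ((t ^ 2 / 8 * ‖alpha s - Real.log n‖ ^ 2 + t / 4 + 1 / 6) / (s.im - 3.33)) - 1

/-- The main term `M_t(s) b_n^t n^{−(s + (t/2)α(s))}` of Prop. 6.1. [cite: Polymath2019, Prop. 6.1] -/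
def rtMain (t : ℝ) (n : ℕ) (s : ℂ) : ℂ :=
  Mt t s * (bCoeff t n : ℂ) * (n : ℂ) ^ (-(s + t / 2 * alpha s))

/-! ## Lemma 5.1 (v) applied to `r_{0,n}`: `r_{0,n}(s) = M₀(s) n^{−s} e^{O_≤(1/(6(Im s − 2)))}` -/

/-- From Lemma 5.1 (v) (tree: `GammaStirling.exists_Gamma_eq_exp_stirling_of_one_lt_im`, error
measured by `Im`): for `Im s > 2`,
`(1/8)(s(s−1)/2) π^{−s/2} Γ(s/2) = M₀(s) exp(O_≤(1/(6(Im s − 2))))` (the source has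
`O_≤(1/(6(|s| − 0.66)))` from Boyd's constant). [cite: Polymath2019, Prop. 6.1, proof, first display] -/
theorem exists_xiFactor_eq_M₀_mul_exp {s : ℂ} (hs : 2 < s.im) :
    ∃ E : ℂ, ‖E‖ ≤ 1 / (6 * (s.im - 2)) ∧ xiFactor s = M₀ s * cexp E := by
  have hz : 1 < (s / 2).im := by rw [Complex.div_ofNat_im]; linarith
  obtain ⟨E, hE, hΓ⟩ :=
    Literature.Analysis.SpecialFunctions.GammaStirling.exists_Gamma_eq_exp_stirling_of_one_lt_im hz
  refine ⟨E, ?_, ?_⟩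
  · rw [Complex.div_ofNat_im] at hE
    convert hE using 2
    ring
  · rw [xiFactor, hΓ, M₀, Complex.exp_add]
    ring

/-- `r_{0,n}(s) = M₀(s) n^{−s} exp(O_≤(1/(6(Im s − 2))))` for `Im s > 2`.
[cite: Polymath2019, Prop. 6.1, proof, first display] -/
theorem exists_r0_eq {n : ℕ} {s : ℂ} (hs : 2 < s.im) :
    ∃ E : ℂ, ‖E‖ ≤ 1 / (6 * (s.im - 2)) ∧ r0 n s = M₀ s * (n : ℂ) ^ (-s) * cexp E := by
  obtain ⟨E, hE, h⟩ := exists_xiFactor_eq_M₀_mul_exp hs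
  exact ⟨E, hE, by rw [r0, h]; ring⟩

/-- `r_{0,n}` is complex differentiable on the upper half-plane (away from the poles of `Γ(s/2)`
and the branch cuts). [cite: Polymath2019, §4, "meromorphic functions" after eq. (ron-def)] -/
theorem differentiableAt_r0 {n : ℕ} (hn : 1 ≤ n) {s : ℂ} (hs : 0 < s.im) :
    DifferentiableAt ℂ (r0 n) s := by
  have hπ : (π : ℂ) ≠ 0 := by exact_mod_cast Real.pi_ne_zero
  have hn0 : (n : ℂ) ≠ 0 := by exact_mod_cast (by omega : n ≠ 0)
  have hΓ : DifferentiableAt ℂ (fun z : ℂ ↦ Complex.Gamma (z / 2)) s := by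
    refine (Complex.differentiableAt_Gamma _ fun m h ↦ ?_).comp s (differentiableAt_id.div_const 2)
    have := congrArg Complex.im h
    simp at this
    linarith
  have h1 : DifferentiableAt ℂ (fun z : ℂ ↦ (π : ℂ) ^ (-z / 2)) s :=
    ((differentiableAt_id.neg).div_const 2).const_cpow (Or.inl hπ)
  have h2 : DifferentiableAt ℂ (fun z : ℂ ↦ (n : ℂ) ^ (-z)) s :=
    (differentiableAt_id.neg).const_cpow (Or.inl hn0)
  have h3 : DifferentiableAt ℂ (fun z : ℂ ↦ 1 / 8 * (z * (z - 1) / 2)) s := by fun_prop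
  have h4 : DifferentiableAt ℂ xiFactor s := by
    have := ((h3.mul h1).mul hΓ)
    exact this
  exact h4.mul h2

/-! ## The bounds (alpha-deriv-bound) for `α'` and the Taylor expansion of `log M₀` -/

/-- (alpha-deriv-bound): for `Im s > 3`, `|α'(s)| ≤ 1/(2 Im(s)²) + 1/Im(s)² + 1/(2 Im s) ≤ 1/(2 Im s − 6)`
(Lemma 5.1 (i)). [cite: Polymath2019, §6.1, eq. (alpha-deriv-bound)] -/
theorem norm_deriv_alpha_le_of_im {s : ℂ} (hs : 3 < s.im) :
    ‖-(1 / (2 * s ^ 2)) - 1 / (s - 1) ^ 2 + 1 / (2 * s)‖ ≤ 1 / (2 * s.im - 6) := by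
  set τ := s.im with hτ
  have hτ0 : 0 < τ := by linarith
  have hns : τ ≤ ‖s‖ := le_trans (le_abs_self _) (Complex.abs_im_le_norm s)
  have hns1 : τ ≤ ‖s - 1‖ := by
    have := Complex.abs_im_le_norm (s - 1)
    rw [Complex.sub_im, Complex.one_im, sub_zero] at this
    exact le_trans (le_abs_self _) this
  have hspos : 0 < ‖s‖ := by linarith
  have hs1pos : 0 < ‖s - 1‖ := by linarith
  have e1 : ‖-(1 / (2 * s ^ 2))‖ ≤ 1 / (2 * τ ^ 2) := by
    rw [norm_neg, norm_div, norm_mul, norm_pow, Complex.norm_two, norm_one]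
    rw [div_le_div_iff₀ (by positivity) (by positivity)]
    nlinarith [mul_le_mul hns hns hτ0.le (norm_nonneg _)]
  have e2 : ‖1 / (s - 1) ^ 2‖ ≤ 1 / τ ^ 2 := by
    rw [norm_div, norm_pow, norm_one, div_le_div_iff₀ (by positivity) (by positivity)]
    nlinarith [mul_le_mul hns1 hns1 hτ0.le (norm_nonneg _)]
  have e3 : ‖1 / (2 * s)‖ ≤ 1 / (2 * τ) := by
    rw [norm_div, norm_mul, Complex.norm_two, norm_one, div_le_div_iff₀ (by positivity) (by positivity)]
    linarith
  have e4 : 1 / (2 * τ ^ 2) + 1 / τ ^ 2 + 1 / (2 * τ) ≤ 1 / (2 * τ - 6) := by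
    rw [show 1 / (2 * τ ^ 2) + 1 / τ ^ 2 + 1 / (2 * τ) = (3 + τ) / (2 * τ ^ 2) by
      field_simp; ring]
    rw [div_le_div_iff₀ (by positivity) (by linarith)]
    nlinarith
  have tri : ‖-(1 / (2 * s ^ 2)) - 1 / (s - 1) ^ 2 + 1 / (2 * s)‖ ≤
      ‖-(1 / (2 * s ^ 2))‖ + ‖1 / (s - 1) ^ 2‖ + ‖1 / (2 * s)‖ := by
    have := norm_add_le (-(1 / (2 * s ^ 2)) - 1 / (s - 1) ^ 2) (1 / (2 * s))
    have := norm_sub_le (-(1 / (2 * s ^ 2))) (1 / (s - 1) ^ 2)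
    linarith
  linarith

/-- Mean value inequality for `α` on a half-plane `Im ≥ T₀ > 3`:
`|α(w) − α(z)| ≤ |w − z|/(2T₀ − 6)`. [cite: Polymath2019, Prop. 6.1, proof ("for all s on the line segment")] -/
theorem norm_alpha_sub_alpha_le_of_im {T₀ : ℝ} (hT₀ : 3 < T₀) {z w : ℂ} (hz : T₀ ≤ z.im)
    (hw : T₀ ≤ w.im) : ‖alpha w - alpha z‖ ≤ 1 / (2 * T₀ - 6) * ‖w - z‖ := by
  have hconv : Convex ℝ {u : ℂ | T₀ ≤ u.im} := by
    intro u hu v hv a b ha hb hab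
    simp only [Set.mem_setOf_eq] at hu hv ⊢
    rw [Complex.add_im, Complex.real_smul, Complex.real_smul, Complex.im_ofReal_mul,
      Complex.im_ofReal_mul]
    nlinarith
  have hpos : ∀ u ∈ {u : ℂ | T₀ ≤ u.im}, 0 < u.im := fun u hu ↦ by
    simp only [Set.mem_setOf_eq] at hu; linarith
  refine hconv.norm_image_sub_le_of_norm_hasDerivWithin_le
    (fun u hu ↦ (hasDerivAt_alpha (hpos u hu)).hasDerivWithinAt)
    (fun u hu ↦ (norm_deriv_alpha_le_of_im (by simp only [Set.mem_setOf_eq] at hu; linarith)).trans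
      ?_) hz hw
  · simp only [Set.mem_setOf_eq] at hu
    exact one_div_le_one_div_of_le (by linarith) (by linarith)

/-- **Taylor expansion of `log M₀` to second order** ("applying Taylor's theorem with remainder to
the branch of the logarithm `log M₀` defined in (logM)"): if `Im s, Im(s + h) ≥ T₀ > 3` then
`log M₀(s + h) = log M₀(s) + α(s) h + O_≤(|h|²/(2(2T₀ − 6)))`.
[cite: Polymath2019, Prop. 6.1, proof] -/
theorem norm_logM₀_taylor_le {T₀ : ℝ} (hT₀ : 3 < T₀) {s h : ℂ} (hs : T₀ ≤ s.im)
    (hsh : T₀ ≤ (s + h).im) :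
    ‖logM₀ (s + h) - logM₀ s - alpha s * h‖ ≤ ‖h‖ ^ 2 / (2 * (2 * T₀ - 6)) := by
  set K : ℝ := 1 / (2 * T₀ - 6) with hK
  have hK0 : 0 ≤ K := by rw [hK]; exact div_nonneg zero_le_one (by linarith)
  -- the path `τ ↦ s + τ h` and the function `f(τ) = log M₀(s + τh) − log M₀(s) − α(s) τ h`
  set f : ℝ → ℂ := fun τ ↦ logM₀ (s + τ * h) - logM₀ s - alpha s * (τ * h) with hf
  set f' : ℝ → ℂ := fun τ ↦ (alpha (s + τ * h) - alpha s) * h with hf'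
  have him : ∀ τ : ℝ, 0 ≤ τ → τ ≤ 1 → T₀ ≤ (s + τ * h).im := by
    intro τ h0 h1
    have e : (s + τ * h).im = (1 - τ) * s.im + τ * (s + h).im := by
      simp [Complex.add_im]; ring
    rw [e]
    nlinarith
  have hderiv : ∀ τ : ℝ, 0 ≤ τ → τ ≤ 1 → HasDerivAt f (f' τ) τ := by
    intro τ h0 h1
    have hpos : 0 < (s + τ * h).im := by linarith [him τ h0 h1]
    have hmul : HasDerivAt (fun τ : ℝ ↦ (τ : ℂ) * h) h τ := by
      simpa using ((hasDerivAt_id τ).ofReal_comp).mul_const h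
    have hlin : HasDerivAt (fun τ : ℝ ↦ s + (τ : ℂ) * h) h τ := by
      simpa using hmul.const_add s
    have h1' : HasDerivAt (fun τ : ℝ ↦ logM₀ (s + (τ : ℂ) * h)) (alpha (s + τ * h) * h) τ := by
      have := (hasDerivAt_logM₀ hpos).comp τ hlin
      simpa only [Function.comp_def] using this
    have h2' : HasDerivAt (fun τ : ℝ ↦ alpha s * ((τ : ℂ) * h)) (alpha s * h) τ :=
      hmul.const_mul (alpha s)
    have := (h1'.sub_const (logM₀ s)).sub h2'
    refine this.congr_deriv ?_
    rw [hf']; ring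
  have hcont : ContinuousOn f (Icc 0 1) := fun τ hτ ↦
    (hderiv τ hτ.1 hτ.2).continuousAt.continuousWithinAt
  -- the comparison bound `B(τ) = K |h|² τ²/2`
  have key := image_norm_le_of_norm_deriv_right_le_deriv_boundary (f := f) (f' := f') (a := 0)
    (b := 1) hcont (fun τ hτ ↦ (hderiv τ hτ.1 hτ.2.le).hasDerivWithinAt)
    (B := fun τ ↦ K * ‖h‖ ^ 2 / 2 * τ ^ 2) (B' := fun τ ↦ K * ‖h‖ ^ 2 * τ)
    (by simp [hf]) (fun τ ↦ by
      have := ((hasDerivAt_pow 2 τ).const_mul (K * ‖h‖ ^ 2 / 2))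
      refine this.congr_deriv ?_
      simp
      ring)
    (fun τ hτ ↦ by
      rw [hf', norm_mul]
      have hτ0 : 0 ≤ τ := hτ.1
      have := norm_alpha_sub_alpha_le_of_im hT₀ hs (him τ hτ.1 hτ.2.le)
      rw [add_sub_cancel_left, norm_mul, Complex.norm_real, Real.norm_of_nonneg hτ0] at this
      calc ‖alpha (s + τ * h) - alpha s‖ * ‖h‖ ≤ 1 / (2 * T₀ - 6) * (τ * ‖h‖) * ‖h‖ := by
            gcongr
        _ = K * ‖h‖ ^ 2 * τ := by rw [hK]; ring)
    (right_mem_Icc.2 zero_le_one)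
  have e1 : f 1 = logM₀ (s + h) - logM₀ s - alpha s * h := by simp [hf]
  rw [← e1]
  refine key.trans (le_of_eq ?_)
  rw [hK]; field_simp

/-- Lower bound for `Im α`: for `Im s = T > 0`, `Im α(s) ≥ −1/(2T) − 1/T` ((iman): the terms
`1/(2s)`, `1/(s−1)` have imaginary parts `≥ −1/(2T)`, `≥ −1/T`, and `Im Log(s/2π) ≥ 0`).
[cite: Polymath2019, Prop. 6.1, proof, eq. (iman)] -/
theorem im_alpha_ge {s : ℂ} (hs : 0 < s.im) : -(1 / (2 * s.im)) - 1 / s.im ≤ (alpha s).im := by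
  have hns : s.im ^ 2 ≤ Complex.normSq s := by rw [Complex.normSq_apply]; nlinarith [sq_nonneg s.re]
  have hns1 : s.im ^ 2 ≤ Complex.normSq (s - 1) := by
    rw [Complex.normSq_apply]
    simp only [Complex.sub_re, Complex.one_re, Complex.sub_im, Complex.one_im, sub_zero]
    nlinarith [sq_nonneg (s.re - 1)]
  have hT2 : 0 < s.im ^ 2 := by positivity
  have hn0 : 0 < Complex.normSq s := lt_of_lt_of_le hT2 hns
  have hn1 : 0 < Complex.normSq (s - 1) := lt_of_lt_of_le hT2 hns1
  have e1 : (1 / (2 * s)).im = -s.im / (2 * Complex.normSq s) := by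
    rw [one_div, Complex.inv_im, Complex.mul_im, Complex.normSq_mul, Complex.normSq_ofNat]
    simp
    field_simp
  have e2 : (1 / (s - 1)).im = -s.im / Complex.normSq (s - 1) := by
    rw [one_div, Complex.inv_im]
    simp
  have h1 : -(1 / (2 * s.im)) ≤ (1 / (2 * s)).im := by
    rw [e1, neg_div, neg_le_neg_iff, div_le_div_iff₀ (by positivity) (by positivity)]
    nlinarith
  have h2 : -(1 / s.im) ≤ (1 / (s - 1)).im := by
    rw [e2, neg_div, neg_le_neg_iff, div_le_div_iff₀ hn1 hs]
    nlinarith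
  have h3 : 0 ≤ (1 / 2 * Complex.log (s / (2 * π))).im := by
    rw [show (1 / 2 : ℂ) = ((1 / 2 : ℝ) : ℂ) by push_cast; ring, Complex.im_ofReal_mul,
      Complex.log_im]
    refine mul_nonneg (by norm_num) (Complex.arg_nonneg_iff.2 ?_)
    rw [show (2 * π : ℂ) = ((2 * π : ℝ) : ℂ) by push_cast; ring, Complex.div_ofReal_im]
    positivity
  rw [alpha, Complex.add_im, Complex.add_im]
  linarith

/-! ## Proof of Proposition 6.1 -/

section Prop61

variable {t σ T : ℝ} {n : ℕ} {s c : ℂ}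

/-- `√t ≤ 1` for `t ≤ 1/2`. [folklore] -/
private theorem sqrt_le_one_of_le_half (ht' : t ≤ 1 / 2) : Real.sqrt t ≤ 1 :=
  Real.sqrt_le_one.mpr (by linarith)

/-- (iman) and "imaginary part at least `T − 0.08`": every point `s + √t w` with `Im w` between `0`
and `Im((√t/2) α_n)` has imaginary part `≥ T − 0.08` (`Im α_n ≥ −1/(2T) − 1/T ≥ −0.15`,
`t ≤ 1/2`). [cite: Polymath2019, Prop. 6.1, proof, eq. (iman)] -/
theorem strip_im_ge (ht : 0 < t) (ht' : t ≤ 1 / 2) (hT : 10 < T) (hs : s = σ + T * I)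
    (hc : c = ((Real.sqrt t / 2 : ℝ) : ℂ) * (alpha s - Real.log n)) {w : ℂ}
    (hw : w.im ∈ uIcc 0 c.im) : T - 0.08 ≤ (s + Real.sqrt t * w).im := by
  have hsim : s.im = T := by rw [hs]; simp
  have hTpos : 0 < T := by linarith
  have hαim : -(3 / (2 * T)) ≤ (alpha s - Real.log n).im := by
    have := im_alpha_ge (s := s) (by rw [hsim]; exact hTpos)
    rw [hsim] at this
    rw [Complex.sub_im, Complex.ofReal_im, sub_zero]
    have e : -(1 / (2 * T)) - 1 / T = -(3 / (2 * T)) := by field_simp; ring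
    linarith
  have hcim : c.im = Real.sqrt t / 2 * (alpha s - Real.log n).im := by
    rw [hc, Complex.im_ofReal_mul]
  have him : (s + Real.sqrt t * w).im = T + Real.sqrt t * w.im := by
    rw [Complex.add_im, hsim, Complex.im_ofReal_mul]
  have h015 : 3 / (2 * T) ≤ 0.15 := by
    rw [div_le_iff₀ (by positivity)]; norm_num; linarith
  have hst : Real.sqrt t * Real.sqrt t = t := Real.mul_self_sqrt ht.le
  have hsq0 : 0 ≤ Real.sqrt t := Real.sqrt_nonneg t
  rw [him]
  rcases mem_uIcc.1 hw with ⟨h0, _⟩ | ⟨h1, _⟩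
  · nlinarith
  · -- `√t · Im w ≥ √t · Im c = (t/2) Im α_n ≥ −(t/2)(3/(2T)) ≥ −0.0375`
    have h2 : Real.sqrt t * c.im ≤ Real.sqrt t * w.im := mul_le_mul_of_nonneg_left h1 hsq0
    have h3' : Real.sqrt t * (Real.sqrt t / 2) = t / 2 := by rw [← mul_div_assoc, hst]
    have h3 : Real.sqrt t * c.im = t / 2 * (alpha s - Real.log n).im := by
      rw [hcim, ← mul_assoc, h3']
    have h4 : -(t / 2 * (3 / (2 * T))) ≤ t / 2 * (alpha s - Real.log n).im := by
      have := mul_le_mul_of_nonneg_left hαim (by linarith : 0 ≤ t / 2)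
      linarith
    have h5 : t / 2 * (3 / (2 * T)) ≤ 1 / 4 * 0.15 :=
      mul_le_mul (by linarith) h015 (by positivity) (by norm_num)
    linarith

/-- **The integrand after the contour shift** (core of the proof of Prop. 6.1): with `s = σ + iT`,
`α_n = α(s) − log n`, `c = (√t/2) α_n` and `w = s + √t v + (t/2) α_n`,
`r_{0,n}(w) e^{−(v+c)²}/√π = (e^{−v²}/√π) · M_t(s) b_n^t n^{−(s+(t/2)α(s))} · exp(E)` with
`|E| ≤ ((t/2) v² + (t²/8)|α_n|² + 1/6)/(T − 3.08)` — Lemma 5.1 (v) at `w` (`Im w ≥ T − 0.08`), the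
second-order Taylor expansion of `log M₀` with `|α'| ≤ 1/(2(T − 3.08))`, the estimate
`|√t v + (t/2)α_n|² ≤ 2tv² + (t²/2)|α_n|²`, and the identity
`M₀(s) exp((t/4)α_n² − s log n) = M_t(s) b_n^t n^{−(s + (t/2)α(s))}`.
[cite: Polymath2019, Prop. 6.1, proof] -/
theorem exists_shifted_integrand_eq (ht : 0 < t) (ht' : t ≤ 1 / 2) (hT : 10 < T) (hn : 1 ≤ n)
    (hs : s = σ + T * I) (hc : c = ((Real.sqrt t / 2 : ℝ) : ℂ) * (alpha s - Real.log n)) (v : ℝ) :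
    ∃ E : ℂ, ‖E‖ ≤ (t / 2 * v ^ 2 + t ^ 2 / 8 * ‖alpha s - Real.log n‖ ^ 2 + 1 / 6) / (T - 3.08) ∧
      r0 n (s + Real.sqrt t * (v + c)) / (Real.sqrt π : ℂ) * cexp (-((v : ℂ) + c) ^ 2) =
        ((Real.exp (-v ^ 2) / Real.sqrt π : ℝ) : ℂ) * rtMain t n s * cexp E := by
  set L : ℝ := Real.log n with hL
  set r : ℝ := Real.sqrt t with hr
  set h : ℂ := (r : ℂ) * (v + c) with hh
  set w : ℂ := s + h with hw
  have hsim : s.im = T := by rw [hs]; simp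
  have hTpos : 0 < T := by linarith
  have hr2 : (r : ℂ) ^ 2 = t := by
    rw [← Complex.ofReal_pow, hr, Real.sq_sqrt ht.le]
  have hT₀ : 3 < T - 0.08 := by linarith
  have hwT₀ : T - 0.08 ≤ w.im := by
    have hmem : ((v : ℂ) + c).im ∈ uIcc 0 c.im := by simp
    have := strip_im_ge (n := n) ht ht' hT hs hc hmem
    simpa [hw, hh, hr] using this
  have hwim2 : 2 < w.im := by linarith
  have hwpos : 0 < w.im := by linarith
  -- Lemma 5.1 (v)
  obtain ⟨E₁, hE₁, hr0w⟩ := exists_r0_eq (n := n) (s := w) hwim2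
  have hE₁' : ‖E₁‖ ≤ 1 / (6 * (T - 3.08)) :=
    hE₁.trans (one_div_le_one_div_of_le (by linarith) (by linarith))
  -- Taylor expansion of `log M₀`
  set E₂ : ℂ := logM₀ w - logM₀ s - alpha s * h with hE₂def
  have hE₂ : ‖E₂‖ ≤ ‖h‖ ^ 2 / (2 * (2 * (T - 0.08) - 6)) :=
    norm_logM₀_taylor_le hT₀ (by rw [hsim]; linarith) (by simpa [hw] using hwT₀)
  -- `|h|² ≤ 2 t v² + (t²/2)|α_n|²`
  have hh' : h = ((r * v : ℝ) : ℂ) + ((t / 2 : ℝ) : ℂ) * (alpha s - L) := by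
    rw [hh, hc]
    push_cast
    linear_combination ((alpha s - L) / 2) * hr2
  have hnh : ‖h‖ ^ 2 ≤ 2 * t * v ^ 2 + t ^ 2 / 2 * ‖alpha s - L‖ ^ 2 := by
    rw [hh']
    have h1 : ‖((r * v : ℝ) : ℂ)‖ ^ 2 = t * v ^ 2 := by
      rw [Complex.norm_real, Real.norm_eq_abs, sq_abs, mul_pow, hr, Real.sq_sqrt ht.le]
    have h2 : ‖((t / 2 : ℝ) : ℂ) * (alpha s - L)‖ ^ 2 = t ^ 2 / 4 * ‖alpha s - L‖ ^ 2 := by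
      rw [norm_mul, Complex.norm_real, Real.norm_of_nonneg (by linarith : (0 : ℝ) ≤ t / 2)]
      ring
    have htri := norm_add_le (((r * v : ℝ) : ℂ)) (((t / 2 : ℝ) : ℂ) * (alpha s - L))
    have hA := norm_nonneg (((r * v : ℝ) : ℂ))
    have hB := norm_nonneg (((t / 2 : ℝ) : ℂ) * (alpha s - L))
    calc ‖((r * v : ℝ) : ℂ) + ((t / 2 : ℝ) : ℂ) * (alpha s - L)‖ ^ 2
        ≤ (‖((r * v : ℝ) : ℂ)‖ + ‖((t / 2 : ℝ) : ℂ) * (alpha s - L)‖) ^ 2 :=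
          pow_le_pow_left₀ (norm_nonneg _) htri 2
      _ ≤ 2 * ‖((r * v : ℝ) : ℂ)‖ ^ 2 + 2 * ‖((t / 2 : ℝ) : ℂ) * (alpha s - L)‖ ^ 2 := by
          nlinarith [sq_nonneg (‖((r * v : ℝ) : ℂ)‖ - ‖((t / 2 : ℝ) : ℂ) * (alpha s - L)‖)]
      _ = 2 * t * v ^ 2 + t ^ 2 / 2 * ‖alpha s - L‖ ^ 2 := by rw [h1, h2]; ring
  have hE : ‖E₁ + E₂‖ ≤ (t / 2 * v ^ 2 + t ^ 2 / 8 * ‖alpha s - L‖ ^ 2 + 1 / 6) / (T - 3.08) := by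
    refine (norm_add_le _ _).trans ?_
    have hden : (0 : ℝ) < T - 3.08 := by linarith
    have hE₂' : ‖E₂‖ ≤ (2 * t * v ^ 2 + t ^ 2 / 2 * ‖alpha s - L‖ ^ 2) / (4 * (T - 3.08)) := by
      refine hE₂.trans ?_
      rw [show 2 * (2 * (T - 0.08) - 6) = 4 * (T - 3.08) by ring]
      exact div_le_div_of_nonneg_right hnh (by linarith)
    have e : 1 / (6 * (T - 3.08)) + (2 * t * v ^ 2 + t ^ 2 / 2 * ‖alpha s - L‖ ^ 2) / (4 * (T - 3.08)) =
        (t / 2 * v ^ 2 + t ^ 2 / 8 * ‖alpha s - L‖ ^ 2 + 1 / 6) / (T - 3.08) := by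
      field_simp
      ring
    linarith
  refine ⟨E₁ + E₂, hE, ?_⟩
  -- the identity of the main terms
  have hw0 : w ≠ 0 := fun e ↦ by rw [e] at hwpos; simp at hwpos
  have hw1 : w ≠ 1 := fun e ↦ by rw [e] at hwpos; simp at hwpos
  have hs0 : s ≠ 0 := fun e ↦ by rw [e] at hsim; simp at hsim; linarith
  have hs1 : s ≠ 1 := fun e ↦ by rw [e] at hsim; simp at hsim; linarith
  have hn0 : (n : ℂ) ≠ 0 := by exact_mod_cast (by omega : n ≠ 0)
  have hlogn : Complex.log (n : ℂ) = (L : ℂ) := by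
    rw [← Complex.ofReal_natCast, ← Complex.ofReal_log (Nat.cast_nonneg n)]
  have hM₀w : M₀ w = cexp (logM₀ s + alpha s * h + E₂) := by
    rw [M₀_eq_exp_logM₀ hw0 hw1, hE₂def]
    congr 1
    ring
  have hM₀s : M₀ s = cexp (logM₀ s) := M₀_eq_exp_logM₀ hs0 hs1
  have hcw : (n : ℂ) ^ (-w) = cexp (-(w * L)) := by
    rw [Complex.cpow_def_of_ne_zero hn0, hlogn]
    ring_nf
  have hcs : (n : ℂ) ^ (-(s + t / 2 * alpha s)) = cexp (-((s + t / 2 * alpha s) * L)) := by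
    rw [Complex.cpow_def_of_ne_zero hn0, hlogn]
    ring_nf
  have hb : (bCoeff t n : ℂ) = cexp ((t / 4 : ℂ) * (L : ℂ) ^ 2) := by
    rw [bCoeff, Complex.ofReal_exp]
    congr 1
    push_cast
    rw [hlogn]
  have hg : ((Real.exp (-v ^ 2) / Real.sqrt π : ℝ) : ℂ) = cexp (-(v : ℂ) ^ 2) / (Real.sqrt π : ℂ) := by
    push_cast
    ring_nf
  have key : logM₀ s + alpha s * h + E₂ + -(w * L) + E₁ + -((v : ℂ) + c) ^ 2 =
      -(v : ℂ) ^ 2 + (t / 4 * alpha s ^ 2 + logM₀ s + t / 4 * (L : ℂ) ^ 2 +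
        -((s + t / 2 * alpha s) * L)) + (E₁ + E₂) := by
    rw [hw, hh, hc]
    push_cast
    linear_combination ((alpha s - L) ^ 2 / 4) * hr2
  rw [hr0w, hM₀w, hcw, rtMain, Mt, hM₀s, hb, hcs, hg]
  calc cexp (logM₀ s + alpha s * h + E₂) * cexp (-(w * L)) * cexp E₁ / (Real.sqrt π : ℂ) *
        cexp (-((v : ℂ) + c) ^ 2)
      = cexp (logM₀ s + alpha s * h + E₂ + -(w * L) + E₁ + -((v : ℂ) + c) ^ 2) /
          (Real.sqrt π : ℂ) := by
        simp only [Complex.exp_add]; ring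
    _ = cexp (-(v : ℂ) ^ 2 + (t / 4 * alpha s ^ 2 + logM₀ s + t / 4 * (L : ℂ) ^ 2 +
          -((s + t / 2 * alpha s) * L)) + (E₁ + E₂)) / (Real.sqrt π : ℂ) := by rw [key]
    _ = cexp (-(v : ℂ) ^ 2) / (Real.sqrt π : ℂ) *
          (cexp (t / 4 * alpha s ^ 2) * cexp (logM₀ s) * cexp (t / 4 * (L : ℂ) ^ 2) *
            cexp (-((s + t / 2 * alpha s) * L))) * cexp (E₁ + E₂) := by
        simp only [Complex.exp_add]; ring

set_option maxHeartbeats 400000 in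
/-- **Sub-Gaussian growth of `r_{0,n}` on the strip of the contour shift** ("`r_{0,n}(s + √t v)`
grows slower than gaussian"): for `Im(s + √t w) ≥ T − 0.08`,
`|r_{0,n}(s + √t w)| ≤ C(s, n) exp((1/4 + 1/(8(T − 3.08))) |w|²)` — from Lemma 5.1 (v) and the
Taylor bound for `log M₀` (rather than from Stirling's formula directly).
[cite: Polymath2019, §4, "grow slower than gaussian"] -/
theorem norm_r0_heat_le (ht : 0 < t) (ht' : t ≤ 1 / 2) (hT : 10 < T) (hn : 1 ≤ n)
    (hs : s = σ + T * I) {w : ℂ} (hw : T - 0.08 ≤ (s + Real.sqrt t * w).im) :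
    ‖r0 n (s + Real.sqrt t * w)‖ ≤
      Real.exp ((logM₀ s).re + 1 + |σ| * Real.log n + (‖alpha s‖ + Real.log n) ^ 2) *
        Real.exp ((1 / 4 + 1 / (8 * (T - 3.08))) * ‖w‖ ^ 2) := by
  set L : ℝ := Real.log n with hL
  set r : ℝ := Real.sqrt t with hr
  set h : ℂ := (r : ℂ) * w with hh
  set z : ℂ := s + h with hz
  have hsim : s.im = T := by rw [hs]; simp
  have hsre : s.re = σ := by rw [hs]; simp
  have hL0 : 0 ≤ L := Real.log_natCast_nonneg n
  have hr0 : 0 ≤ r := Real.sqrt_nonneg t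
  have hr1 : r ≤ 1 := sqrt_le_one_of_le_half ht'
  have hr2 : r ^ 2 = t := Real.sq_sqrt ht.le
  have hT₀ : 3 < T - 0.08 := by linarith
  have hzim : T - 0.08 ≤ z.im := hw
  have hz2 : 2 < z.im := by linarith
  have hzpos : 0 < z.im := by linarith
  obtain ⟨E₁, hE₁, hr0z⟩ := exists_r0_eq (n := n) (s := z) hz2
  have hE₁' : ‖E₁‖ ≤ 1 := by
    refine hE₁.trans ?_
    rw [div_le_one (by linarith)]
    linarith
  set E₂ : ℂ := logM₀ z - logM₀ s - alpha s * h with hE₂def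
  have hE₂ : ‖E₂‖ ≤ ‖h‖ ^ 2 / (2 * (2 * (T - 0.08) - 6)) :=
    norm_logM₀_taylor_le hT₀ (by rw [hsim]; linarith) (by simpa [hz] using hzim)
  have hz0 : z ≠ 0 := fun e ↦ by rw [e] at hzpos; simp at hzpos
  have hz1 : z ≠ 1 := fun e ↦ by rw [e] at hzpos; simp at hzpos
  have hn0 : (n : ℂ) ≠ 0 := by exact_mod_cast (by omega : n ≠ 0)
  have hlogn : Complex.log (n : ℂ) = (L : ℂ) := by
    rw [← Complex.ofReal_natCast, ← Complex.ofReal_log (Nat.cast_nonneg n)]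
  -- norms of the three factors
  have hnh : ‖h‖ ≤ ‖w‖ := by
    rw [hh, norm_mul, Complex.norm_real, Real.norm_of_nonneg hr0]
    exact mul_le_of_le_one_left (norm_nonneg _) hr1
  have hnh2 : ‖h‖ ^ 2 ≤ ‖w‖ ^ 2 / 2 := by
    rw [hh, norm_mul, Complex.norm_real, Real.norm_of_nonneg hr0, mul_pow, hr2]
    nlinarith [sq_nonneg ‖w‖]
  have hM : ‖M₀ z‖ ≤ Real.exp ((logM₀ s).re + ‖alpha s‖ * ‖w‖ + ‖w‖ ^ 2 / (8 * (T - 3.08))) := by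
    rw [M₀_eq_exp_logM₀ hz0 hz1, Complex.norm_exp, Real.exp_le_exp]
    have e : logM₀ z = logM₀ s + alpha s * h + E₂ := by rw [hE₂def]; ring
    rw [e, Complex.add_re, Complex.add_re]
    have h1 : (alpha s * h).re ≤ ‖alpha s‖ * ‖w‖ :=
      (Complex.re_le_norm _).trans (by rw [norm_mul]; gcongr)
    have h2 : E₂.re ≤ ‖w‖ ^ 2 / (8 * (T - 3.08)) := by
      refine (Complex.re_le_norm _).trans (hE₂.trans ?_)
      rw [show 2 * (2 * (T - 0.08) - 6) = 4 * (T - 3.08) by ring, div_le_div_iff₀ (by linarith) (by linarith)]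
      nlinarith
    linarith
  have hN : ‖(n : ℂ) ^ (-z)‖ ≤ Real.exp (|σ| * L + L * ‖w‖) := by
    rw [Complex.cpow_def_of_ne_zero hn0, hlogn, Complex.norm_exp, Real.exp_le_exp]
    have e : (((L : ℝ) : ℂ) * -z).re = -(L * z.re) := by
      simp [Complex.mul_re]
    rw [e, hz, Complex.add_re, hsre, hh, Complex.re_ofReal_mul]
    have h1 : -(L * σ) ≤ |σ| * L := by nlinarith [neg_abs_le σ, le_abs_self σ]
    have h2 : -(L * (r * w.re)) ≤ L * ‖w‖ := by
      have := Complex.abs_re_le_norm w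
      have h3 : |r * w.re| ≤ ‖w‖ := by
        rw [abs_mul, abs_of_nonneg hr0]
        exact (mul_le_of_le_one_left (abs_nonneg _) hr1).trans this
      nlinarith [neg_abs_le (r * w.re)]
    nlinarith
  have hX : ‖cexp E₁‖ ≤ Real.exp 1 := by
    rw [Complex.norm_exp, Real.exp_le_exp]
    exact (Complex.re_le_norm _).trans hE₁'
  -- assemble
  have hAM : (‖alpha s‖ + L) * ‖w‖ ≤ (‖alpha s‖ + L) ^ 2 + ‖w‖ ^ 2 / 4 := by
    nlinarith [sq_nonneg (‖alpha s‖ + L - ‖w‖ / 2)]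
  rw [hr0z, norm_mul, norm_mul]
  calc ‖M₀ z‖ * ‖(n : ℂ) ^ (-z)‖ * ‖cexp E₁‖
      ≤ Real.exp ((logM₀ s).re + ‖alpha s‖ * ‖w‖ + ‖w‖ ^ 2 / (8 * (T - 3.08))) *
          Real.exp (|σ| * L + L * ‖w‖) * Real.exp 1 := by
        gcongr
    _ = Real.exp ((logM₀ s).re + ‖alpha s‖ * ‖w‖ + ‖w‖ ^ 2 / (8 * (T - 3.08)) +
          (|σ| * L + L * ‖w‖) + 1) := by simp only [Real.exp_add]
    _ ≤ Real.exp (((logM₀ s).re + 1 + |σ| * L + (‖alpha s‖ + L) ^ 2) +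
          (1 / 4 + 1 / (8 * (T - 3.08))) * ‖w‖ ^ 2) := by
        rw [Real.exp_le_exp]
        have e : (1 / 4 + 1 / (8 * (T - 3.08))) * ‖w‖ ^ 2 = ‖w‖ ^ 2 / 4 + ‖w‖ ^ 2 / (8 * (T - 3.08)) := by
          ring
        nlinarith [e]
    _ = _ := by rw [Real.exp_add]

/-- The elementary inequality closing the proof of Prop. 6.1: with `a = |α_n|²`,
`exp(((t²/8)a + 1/6)/(T − 3.08)) (1 − t/(2(T − 3.08)))^{−1/2} − 1 ≤ ε_{t,n}` — the Gaussian integral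
`∫ exp(tv²/(2(T−3.08))) e^{−v²}/√π dv = (1 − t/(2(T−3.08)))^{−1/2}` and Lemma 5.1 (ii):
`1 − t/(2(T−3.08)) = exp(O_≤(t/(2(T−3.33))))` for `t ≤ 1/2`, `T ≥ 10`.
[cite: Polymath2019, Prop. 6.1, proof, eq. (gauss-bound)] -/
theorem eps_ineq {a : ℝ} (ht : 0 < t) (ht' : t ≤ 1 / 2) (hT : 10 < T) (ha : 0 ≤ a) :
    Real.exp ((t ^ 2 / 8 * a + 1 / 6) / (T - 3.08)) / Real.sqrt (1 - t / (2 * (T - 3.08))) - 1 ≤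
      Real.exp ((t ^ 2 / 8 * a + t / 4 + 1 / 6) / (T - 3.33)) - 1 := by
  set P : ℝ := t ^ 2 / 8 * a + 1 / 6 with hP
  set κ : ℝ := t / (2 * (T - 3.08)) with hκ
  set y : ℝ := t / (2 * (T - 3.33)) with hy
  have hP0 : 0 ≤ P := by positivity
  have hd1 : 0 < T - 3.08 := by linarith
  have hd2 : 0 < T - 3.33 := by linarith
  have hκ1 : κ < 1 := by
    rw [hκ, div_lt_one (by positivity)]; linarith
  have h1κ : 0 < 1 - κ := by linarith
  -- `exp(P/(T-3.08)) ≤ exp(P/(T-3.33))`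
  have hA : Real.exp (P / (T - 3.08)) ≤ Real.exp (P / (T - 3.33)) := by
    rw [Real.exp_le_exp]
    exact div_le_div_of_nonneg_left hP0 hd2 (by linarith)
  -- `(1-κ)(1+y) ≥ 1`
  have hB : 1 ≤ (1 - κ) * (1 + y) := by
    have e : (1 - κ) * (1 + y) - 1 = t / (2 * (T - 3.08)) * ((1 / 2 - t) / (2 * (T - 3.33))) := by
      rw [hκ, hy]; field_simp; ring
    have : 0 ≤ t / (2 * (T - 3.08)) * ((1 / 2 - t) / (2 * (T - 3.33))) := by
      apply mul_nonneg (by positivity)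
      exact div_nonneg (by linarith) (by positivity)
    linarith
  -- `1/√(1-κ) ≤ exp(y/2)`
  have hC : 1 / Real.sqrt (1 - κ) ≤ Real.exp (y / 2) := by
    have h1 : 1 / (1 - κ) ≤ Real.exp y := by
      rw [div_le_iff₀ h1κ]
      have := Real.add_one_le_exp y
      nlinarith
    have h2 : Real.sqrt (1 / (1 - κ)) ≤ Real.sqrt (Real.exp y) := Real.sqrt_le_sqrt h1
    have h3 : Real.sqrt (Real.exp y) = Real.exp (y / 2) := by
      rw [show Real.exp y = Real.exp (y / 2) ^ 2 by rw [sq, ← Real.exp_add]; ring_nf,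
        Real.sqrt_sq (Real.exp_pos _).le]
    rw [Real.sqrt_div' 1 h1κ.le, Real.sqrt_one] at h2
    rw [h3] at h2
    exact h2
  have hpos : 0 < Real.sqrt (1 - κ) := Real.sqrt_pos.2 h1κ
  calc Real.exp (P / (T - 3.08)) / Real.sqrt (1 - κ) - 1
      = Real.exp (P / (T - 3.08)) * (1 / Real.sqrt (1 - κ)) - 1 := by ring
    _ ≤ Real.exp (P / (T - 3.33)) * Real.exp (y / 2) - 1 := by
        gcongr
    _ = Real.exp ((P + t / 4) / (T - 3.33)) - 1 := by
        rw [← Real.exp_add]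
        congr 2
        rw [hy]; field_simp; ring
    _ = Real.exp ((t ^ 2 / 8 * a + t / 4 + 1 / 6) / (T - 3.33)) - 1 := by
        rw [hP]; ring_nf

/-- "`(1/√π) e^{−v²} dv` integrates to one." [cite: Polymath2019, Prop. 6.1, proof] -/
theorem integral_gaussWeight : ∫ v : ℝ, Real.exp (-v ^ 2) / Real.sqrt π = 1 := by
  have h := integral_gaussian 1
  simp only [neg_mul, one_mul, div_one] at h
  rw [MeasureTheory.integral_div, h, div_self (Real.sqrt_pos.2 Real.pi_pos).ne']

/-- **Polymath 15, Proposition 6.1 (estimate for `r_{t,n}`).** For `σ` real, `T > 10`, `n ≥ 1` and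
`0 < t ≤ 1/2`, with `s = σ + iT`:
`|r_{t,n}(s) − M_t(s) b_n^t n^{−(s+(t/2)α(s))}| ≤ |M_t(s) b_n^t n^{−(s+(t/2)α(s))}| · ε_{t,n}(s)`,
i.e. `r_{t,n}(σ+iT) = M_t(σ+iT) (b_n^t/n^{σ+iT+(t/2)α(σ+iT)}) (1 + O_≤(ε_{t,n}(σ+iT)))`.
Proof as printed: shift the contour `v ↦ v + (√t/2)α_n` (`integral_gaussian_shift`; legitimate
since `Im s` and `Im(s + (t/2)α_n) ≥ T − 0.08` have the same sign), apply Lemma 5.1 (v) and the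
Taylor expansion of `log M₀` pointwise (`exists_shifted_integrand_eq`), bound
`|e^E − 1| ≤ e^{|E|} − 1` (Lemma 5.1 (iv)), evaluate the Gaussian integral
`∫ e^{tv²/(2(T−3.08))} e^{−v²}/√π = (1 − t/(2(T−3.08)))^{−1/2}` and use Lemma 5.1 (ii)
(`eps_ineq`). [cite: Polymath2019, Prop. 6.1] -/
theorem norm_rt_sub_rtMain_le (ht : 0 < t) (ht' : t ≤ 1 / 2) (hT : 10 < T) (hn : 1 ≤ n) :
    ‖rt t n ((σ : ℂ) + T * I) - rtMain t n ((σ : ℂ) + T * I)‖ ≤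
      ‖rtMain t n ((σ : ℂ) + T * I)‖ * epsTN t n ((σ : ℂ) + T * I) := by
  set s : ℂ := σ + T * I with hs
  set L : ℝ := Real.log n with hL
  set c : ℂ := ((Real.sqrt t / 2 : ℝ) : ℂ) * (alpha s - L) with hc
  set G : ℂ → ℂ := fun w ↦ r0 n (s + Real.sqrt t * w) / (Real.sqrt π : ℂ) with hG
  set A : ℝ := 1 / 4 + 1 / (8 * (T - 3.08)) with hA
  set B : ℝ := Real.exp ((logM₀ s).re + 1 + |σ| * L + (‖alpha s‖ + L) ^ 2) / Real.sqrt π with hB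
  have hsim : s.im = T := by simp [hs]
  have hden : 0 < T - 3.08 := by linarith
  have hsqπ : 0 < Real.sqrt π := Real.sqrt_pos.2 Real.pi_pos
  have hA1 : A < 1 := by
    have : 1 / (8 * (T - 3.08)) ≤ 1 / 8 := one_div_le_one_div_of_le (by norm_num) (by linarith)
    rw [hA]; linarith
  -- hypotheses of the contour shift: holomorphy and sub-Gaussian growth on the strip
  have hd : ∀ w : ℂ, w.im ∈ uIcc 0 c.im → DifferentiableAt ℂ G w := by
    intro w hw
    have him := strip_im_ge (n := n) ht ht' hT hs hc hw
    have hpos : 0 < (s + Real.sqrt t * w).im := by linarith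
    have h1 : DifferentiableAt ℂ (fun w : ℂ ↦ r0 n (s + Real.sqrt t * w)) w := by
      have h2 : DifferentiableAt ℂ (fun w : ℂ ↦ s + Real.sqrt t * w) w := by fun_prop
      have := (differentiableAt_r0 hn hpos).comp w h2
      simpa only [Function.comp_def] using this
    simpa only [hG] using h1.div_const (Real.sqrt π : ℂ)
  have hg : ∀ w : ℂ, w.im ∈ uIcc 0 c.im → ‖G w‖ ≤ B * Real.exp (A * ‖w‖ ^ 2) := by
    intro w hw
    have him := strip_im_ge (n := n) ht ht' hT hs hc hw
    have h1 := norm_r0_heat_le ht ht' hT hn hs him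
    simp only [hG]
    rw [norm_div, Complex.norm_real, Real.norm_of_nonneg hsqπ.le, hB, hA, div_mul_eq_mul_div]
    exact div_le_div_of_nonneg_right h1 hsqπ.le
  -- Step 1: `r_{t,n}(s) = ∫ G(v) e^{-v²} dv = ∫ G(v + c) e^{-(v+c)²} dv`
  set Φ : ℝ → ℂ := fun v ↦ G (v + c) * cexp (-((v : ℂ) + c) ^ 2) with hΦ
  have hrt : rt t n s = ∫ v : ℝ, Φ v := by
    simp only [hΦ]
    rw [integral_gaussian_shift hA1 hd hg, rt, heatAvg]
    refine integral_congr_ae (Eventually.of_forall fun v ↦ ?_)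
    simp only [hG]
    push_cast
    ring
  -- Step 2: the shifted integrand is `g(v) · main · e^{E(v)}` pointwise
  set g : ℝ → ℝ := fun v ↦ Real.exp (-v ^ 2) / Real.sqrt π with hg'
  set Mn : ℂ := rtMain t n s with hMn
  set b₀ : ℝ := (t ^ 2 / 8 * ‖alpha s - L‖ ^ 2 + 1 / 6) / (T - 3.08) with hb₀
  set κ : ℝ := t / (2 * (T - 3.08)) with hκ
  have hκ1 : κ < 1 := by rw [hκ, div_lt_one (by positivity)]; linarith
  have hg0 : ∀ v, 0 ≤ g v := fun v ↦ by positivity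
  have hpt : ∀ v : ℝ, ‖Φ v - (g v : ℂ) * Mn‖ ≤ ‖Mn‖ * (g v * (Real.exp (b₀ + κ * v ^ 2) - 1)) := by
    intro v
    obtain ⟨E, hE, hEq⟩ := exists_shifted_integrand_eq ht ht' hT hn hs hc v
    have hEq' : Φ v = (g v : ℂ) * Mn * cexp E := by
      simp only [hΦ, hG, hg', hMn]
      exact hEq
    have hb : (t / 2 * v ^ 2 + t ^ 2 / 8 * ‖alpha s - L‖ ^ 2 + 1 / 6) / (T - 3.08) =
        b₀ + κ * v ^ 2 := by
      rw [hb₀, hκ]; field_simp; ring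
    rw [hEq', show (g v : ℂ) * Mn * cexp E - (g v : ℂ) * Mn = (g v : ℂ) * Mn * (cexp E - 1) by ring,
      norm_mul, norm_mul, Complex.norm_real, Real.norm_of_nonneg (hg0 v)]
    have h1 : ‖cexp E - 1‖ ≤ Real.exp ‖E‖ - 1 := by
      simpa using Complex.norm_exp_sub_sum_le_exp_norm_sub_sum E 1
    have h2 : Real.exp ‖E‖ - 1 ≤ Real.exp (b₀ + κ * v ^ 2) - 1 := by
      rw [← hb]; gcongr
    calc g v * ‖Mn‖ * ‖cexp E - 1‖ ≤ g v * ‖Mn‖ * (Real.exp (b₀ + κ * v ^ 2) - 1) := by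
          have : 0 ≤ g v * ‖Mn‖ := mul_nonneg (hg0 v) (norm_nonneg _)
          exact mul_le_mul_of_nonneg_left (h1.trans h2) this
      _ = ‖Mn‖ * (g v * (Real.exp (b₀ + κ * v ^ 2) - 1)) := by ring
  -- Step 3: integrability of everything in sight
  have hΦi : Integrable Φ := integrable_gaussian_shift hA1 hd hg
  have hgi : Integrable g := by
    have := (integrable_exp_neg_mul_sq (zero_lt_one)).div_const (Real.sqrt π)
    refine this.congr (Eventually.of_forall fun v ↦ ?_)
    simp [hg']
  have hgC : Integrable fun v : ℝ ↦ (g v : ℂ) * Mn := hgi.ofReal.mul_const Mn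
  have hg1 : ∫ v : ℝ, g v = 1 := by simp only [hg']; exact integral_gaussWeight
  have hfun : (fun v : ℝ ↦ g v * (Real.exp (b₀ + κ * v ^ 2) - 1)) =
      fun v ↦ Real.exp b₀ / Real.sqrt π * Real.exp (-(1 - κ) * v ^ 2) - g v := by
    funext v
    simp only [hg']
    rw [mul_sub, mul_one, Real.exp_add]
    have : Real.exp (-v ^ 2) * Real.exp (κ * v ^ 2) = Real.exp (-(1 - κ) * v ^ 2) := by
      rw [← Real.exp_add]; ring_nf
    rw [← this]
    ring
  have hmaji : Integrable fun v : ℝ ↦ g v * (Real.exp (b₀ + κ * v ^ 2) - 1) := by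
    rw [hfun]
    exact ((integrable_exp_neg_mul_sq (by linarith)).const_mul _).sub hgi
  have hmaj : Integrable fun v : ℝ ↦ ‖Mn‖ * (g v * (Real.exp (b₀ + κ * v ^ 2) - 1)) :=
    hmaji.const_mul _
  -- Step 4: the value of the majorant integral
  have hval : ∫ v : ℝ, g v * (Real.exp (b₀ + κ * v ^ 2) - 1) =
      Real.exp b₀ / Real.sqrt (1 - κ) - 1 := by
    rw [hfun, integral_sub ((integrable_exp_neg_mul_sq (by linarith)).const_mul _) hgi,
      MeasureTheory.integral_const_mul, integral_gaussian (1 - κ), hg1, Real.sqrt_div' π (by linarith)]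
    field_simp
  -- Step 5: the chain of (in)equalities
  have hdiff : rt t n s - Mn = ∫ v : ℝ, (Φ v - (g v : ℂ) * Mn) := by
    rw [integral_sub hΦi hgC, ← hrt, MeasureTheory.integral_mul_const, integral_complex_ofReal, hg1]
    simp
  calc ‖rt t n s - Mn‖ = ‖∫ v : ℝ, (Φ v - (g v : ℂ) * Mn)‖ := by rw [hdiff]
    _ ≤ ∫ v : ℝ, ‖Φ v - (g v : ℂ) * Mn‖ := norm_integral_le_integral_norm _
    _ ≤ ∫ v : ℝ, ‖Mn‖ * (g v * (Real.exp (b₀ + κ * v ^ 2) - 1)) :=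
        integral_mono (hΦi.sub hgC).norm hmaj hpt
    _ = ‖Mn‖ * (Real.exp b₀ / Real.sqrt (1 - κ) - 1) := by
        rw [MeasureTheory.integral_const_mul, hval]
    _ ≤ ‖Mn‖ * epsTN t n s := by
        refine mul_le_mul_of_nonneg_left ?_ (norm_nonneg _)
        have := eps_ineq (a := ‖alpha s - L‖ ^ 2) ht ht' hT (sq_nonneg _)
        rw [epsTN, hsim]
        simpa only [hb₀, hκ, hL] using this

/-- **Polymath 15, Proposition 6.1**, in the quantifier form of the typed decomposition of
Thm. 1.3 (THEORY-R6, item E1 `rtn_estimate`). [cite: Polymath2019, Prop. 6.1] -/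
theorem rtn_estimate :
    ∀ t σ T : ℝ, ∀ n : ℕ, 0 < t → t ≤ 1 / 2 → 10 < T → 1 ≤ n →
      ‖rt t n ((σ : ℂ) + T * I) - rtMain t n ((σ : ℂ) + T * I)‖ ≤
        ‖rtMain t n ((σ : ℂ) + T * I)‖ * epsTN t n ((σ : ℂ) + T * I) :=
  fun _ _ _ _ ht ht' hT hn ↦ norm_rt_sub_rtMain_le ht ht' hT hn

end Prop61

end Polymath15

end Literature.NumberTheory.LFunctions

end
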